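import Mathlib
import HarnessLib
import Summits.ValiantsHypothesis.ValiantsHypothesis.Theorems.MonotoneRestorationOrbitRestorationQPBlockSigns

/-!
# Squares of matrix-symmetric affine products have polynomial orbits (SPAN currency; census R2)

Route MonotoneRestoration, crux `OrbitRestorationQP` (stmt-ValiantsHypothesis-18293), SPAN-currency lane of the open
sub-rung A_∞ (`stub_sigmaPiSigmaValue`), `ΠΣ` part.  Helper (`--supports`), def-free.  Item R2 of `BLOCK-LANE-g7g5.md` §3.

* `exists_polyU_block_eq_aeval` — a support block (product of the degree-one factors with row/column supports `(A, T)`)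
  is a placed polynomial local form with `U` at the canonical placement of `(A, T)`;
* `label_eq_of_block_sq_eq` — if `C c · B_l² = C d · B_{l'}²` (`d ≠ 0`, `B_l` a nonempty block) then `l' = l`
  (unique factorisation: a degree-one factor of `B_l` divides a factor of `B_{l'}`, and labels are unit-invariant);
* **`sq_mem_narrowSpan_of_matrixSymmetric_supports`** — for EVERY nonzero product `C a · Π_i L_i` of degree-one forms
  invariant under all row/column renamings, with supports `R, S` as delivered by
  `LocalFactors.exists_rowColSupports_of_matrixSymmetric` (`|R|, |S| < k`), the SQUARE `(C a · Π_i L_i)²` lies in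
  `span_ℂ {hom_{F,n} : tw F ≤ 2k − 1}`.  Proof: the doubled family has blocks `B_l²`; a renaming rescaling `B_l²` fixes
  the label (`label_eq_of_block_sq_eq`), so acts on `B_l` by a block eigen-scalar, which is a SIGN
  (`blockScalar_eq_one_or_eq_neg_one`); hence `B_l²` is untwisted and `prod_mem_narrowSpan_of_supportBlockUntwisted`
  applies.

So sign twists are the ONLY obstruction to span-A₁, and they die in the square: the remaining problem of the `ΠΣ`
sub-rung in span currency is a SQUARE-ROOT problem (template: column Vandermondes via Cauchy–Binet,
`…ColumnVandermondesNarrow.lean`).  No registered stub is closed; the crux and VP ≠ VNP are not moved. [folklore]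
-/

noncomputable section

open scoped Pointwise

-- `Summit.ValiantsHypothesis.ValiantsHypothesis.…` is the tree's single-conjunct layout (Sub = Summit).
set_option linter.dupNamespace false

namespace Summit.ValiantsHypothesis.ValiantsHypothesis.Theorems

namespace NormalisedFactors

open MvPolynomial Finset Equiv ProductAction
open Literature.Computability.AlgebraicComplexity (homPoly)
open Literature.Combinatorics.SimpleGraph (treewidth)

variable {n : ℕ}

/-! ### Support blocks are placed polynomial local forms -/

/-- **A support block is a placed polynomial local form with `U` at the canonical placement of its supports.** [folklore] -/
theorem exists_polyU_block_eq_aeval {ι : Type} [Fintype ι] (L : ι → MvPolynomial (Fin n × Fin n) ℂ)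
    (hL1 : ∀ i, (L i).totalDegree = 1) (R S : MvPolynomial (Fin n × Fin n) ℂ → Finset (Fin n))
    (hRfix : ∀ (i : ι) (ρ : Perm (Fin n)), (∀ x ∈ R (L i), ρ x = x) →
      rename (fun P : Fin n × Fin n => (ρ P.1, P.2)) (L i) = L i)
    (hSfix : ∀ (i : ι) (ρ : Perm (Fin n)), (∀ x ∈ S (L i), ρ x = x) →
      rename (fun P : Fin n × Fin n => (P.1, ρ P.2)) (L i) = L i)
    (A T : Finset (Fin n)) :
    ∃ P : MvPolynomial (((Fin A.card × Fin T.card) ⊕ (Fin A.card ⊕ Fin T.card)) ⊕ Unit) ℂ,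
      (∏ i ∈ (univ : Finset ι).filter (fun i => (R (L i), S (L i)) = (A, T)), L i) =
        aeval (Sum.elim (Sum.elim
          (fun ab : Fin A.card × Fin T.card =>
            (X (((A.equivFin.symm ab.1 : A) : Fin n), ((T.equivFin.symm ab.2 : T) : Fin n)) : MvPolynomial (Fin n × Fin n) ℂ))
          (Sum.elim (fun a : Fin A.card => ∑ j : Fin n, (X (((A.equivFin.symm a : A) : Fin n), j) : MvPolynomial (Fin n × Fin n) ℂ))
            (fun b : Fin T.card => ∑ j : Fin n, (X (j, ((T.equivFin.symm b : T) : Fin n)) : MvPolynomial (Fin n × Fin n) ℂ))))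
          (fun _ : Unit => ∑ i : Fin n, ∑ j : Fin n, (X (i, j) : MvPolynomial (Fin n × Fin n) ℂ))) P := by
  classical
  have hP : ∀ i : {i // (R (L i), S (L i)) = (A, T)}, ∃ P : MvPolynomial (((Fin A.card × Fin T.card) ⊕
      (Fin A.card ⊕ Fin T.card)) ⊕ Unit) ℂ,
      L i = aeval (Sum.elim (Sum.elim
        (fun ab : Fin A.card × Fin T.card =>
          (X (((A.equivFin.symm ab.1 : A) : Fin n), ((T.equivFin.symm ab.2 : T) : Fin n)) : MvPolynomial (Fin n × Fin n) ℂ))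
        (Sum.elim (fun a : Fin A.card => ∑ j : Fin n, (X (((A.equivFin.symm a : A) : Fin n), j) : MvPolynomial (Fin n × Fin n) ℂ))
          (fun b : Fin T.card => ∑ j : Fin n, (X (j, ((T.equivFin.symm b : T) : Fin n)) : MvPolynomial (Fin n × Fin n) ℂ))))
        (fun _ : Unit => ∑ i : Fin n, ∑ j : Fin n, (X (i, j) : MvPolynomial (Fin n × Fin n) ℂ))) P := by
    rintro ⟨i, hi⟩
    have hRi : R (L i) = A := congrArg Prod.fst hi
    have hSi : S (L i) = T := congrArg Prod.snd hi
    exact exists_polyU_eq_aeval_of_rowCol_invariant (L i) (hL1 i).le A T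
      (fun ρ hρ => hRfix i ρ (by rw [hRi]; exact hρ)) (fun ρ hρ => hSfix i ρ (by rw [hSi]; exact hρ))
  choose Pf hPf using hP
  refine ⟨∏ i : {i // (R (L i), S (L i)) = (A, T)}, Pf i, ?_⟩
  rw [map_prod, Finset.prod_subtype ((univ : Finset ι).filter fun i => (R (L i), S (L i)) = (A, T))
    (p := fun i => (R (L i), S (L i)) = (A, T)) (fun i => by simp) L]
  exact Fintype.prod_congr _ _ fun i => hPf i

/-! ### A rescaled square of a block determines the label -/

/-- **`C c · B_l² = C d · B_{l'}²` with `d ≠ 0` and `B_l` nonempty forces `l' = l`.** [folklore] -/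
theorem label_eq_of_block_sq_eq {ι Λ : Type} [Fintype ι] [DecidableEq Λ] (L : ι → MvPolynomial (Fin n × Fin n) ℂ)
    (hL1 : ∀ i, (L i).totalDegree = 1) (hL0 : ∀ i, L i ≠ 0) (lab : MvPolynomial (Fin n × Fin n) ℂ → Λ)
    (hlab_unit : ∀ (q : MvPolynomial (Fin n × Fin n) ℂ) (u : ℂ), u ≠ 0 → lab (C u * q) = lab q)
    (l l' : Λ) (hl : ∃ i, lab (L i) = l) (c d : ℂ) (hd : d ≠ 0)
    (h : C c * (∏ i ∈ (univ : Finset ι).filter (fun i => lab (L i) = l), L i) ^ 2 =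
      C d * (∏ i ∈ (univ : Finset ι).filter (fun i => lab (L i) = l'), L i) ^ 2) : l' = l := by
  classical
  obtain ⟨i, hi⟩ := hl
  have hprime : Prime (L i) := RankBoundBridge.prime_of_totalDegree_eq_one (hL1 i)
  have hmem : i ∈ (univ : Finset ι).filter (fun i => lab (L i) = l) := by simp [hi]
  have hdvd : L i ∣ C d * (∏ j ∈ (univ : Finset ι).filter (fun j => lab (L j) = l'), L j) ^ 2 := by
    rw [← h, pow_two, ← mul_assoc]
    exact Dvd.dvd.mul_left (Finset.dvd_prod_of_mem _ hmem) _
  rcases hprime.dvd_or_dvd hdvd with h1 | h1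
  · exact absurd (isUnit_of_dvd_unit h1 ((isUnit_iff_ne_zero.2 hd).map C)) hprime.not_unit
  · have h2 := hprime.dvd_of_dvd_pow h1
    obtain ⟨j, hj, hij⟩ := (Prime.dvd_finsetProd_iff hprime _).1 h2
    obtain ⟨q, hq⟩ := hij
    have hj0 : L j ≠ 0 := hL0 j
    have hq0 : q ≠ 0 := by rintro rfl; exact hj0 (by rw [hq, mul_zero])
    have hdq : q.totalDegree = 0 := by
      have := totalDegree_mul_of_isDomain (hL0 i) hq0
      rw [← hq, hL1 j, hL1 i] at this
      omega
    obtain ⟨w, hw⟩ : ∃ w : ℂ, q = C w := ⟨_, (totalDegree_eq_zero_iff_eq_C (p := q)).1 hdq⟩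
    have hw0 : w ≠ 0 := by rintro rfl; exact hq0 (by rw [hw, C_0])
    have hlabj : lab (L j) = l := by rw [hq, hw, mul_comm, hlab_unit _ w hw0, hi]
    have := (Finset.mem_filter.1 hj).2
    rw [hlabj] at this
    exact this.symm

/-! ### Squares are block-untwisted -/

/-- **SQUARES OF MATRIX-SYMMETRIC AFFINE PRODUCTS HAVE POLYNOMIAL ORBITS (span currency).**  For every nonzero product
`C a · Π_i L_i` of degree-one forms invariant under all row/column renamings, with row/column supports `R, S` of sizes
`< k` (as delivered by `LocalFactors.exists_rowColSupports_of_matrixSymmetric`), `(C a · Π_i L_i)² ∈ span_ℂ {hom_{F,n} : tw F ≤ 2k − 1}`.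
[folklore; cite: DwivediPagoSeppelt2026, §8; DixonMortimer1996, Thm 5.2B] -/
theorem sq_mem_narrowSpan_of_matrixSymmetric_supports {k : ℕ} (hk : 1 ≤ k) {ι : Type} [Fintype ι]
    (L : ι → MvPolynomial (Fin n × Fin n) ℂ) (a : ℂ) (hL1 : ∀ i, (L i).totalDegree = 1) (hf0 : C a * ∏ i, L i ≠ 0)
    (hfix : ∀ σ τ : Perm (Fin n),
      rename (fun P : Fin n × Fin n => (σ P.1, τ P.2)) (C a * ∏ i, L i) = C a * ∏ i, L i)
    (R S : MvPolynomial (Fin n × Fin n) ℂ → Finset (Fin n))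
    (R1 : ∀ (q : MvPolynomial (Fin n × Fin n) ℂ) (u : ℂ), u ≠ 0 → R (C u * q) = R q)
    (S1 : ∀ (q : MvPolynomial (Fin n × Fin n) ℂ) (u : ℂ), u ≠ 0 → S (C u * q) = S q)
    (R2 : ∀ (q : MvPolynomial (Fin n × Fin n) ℂ) (σ : Perm (Fin n)), R (vact (K := ℂ) rowHom σ q) = σ • R q)
    (R3 : ∀ (q : MvPolynomial (Fin n × Fin n) ℂ) (τ : Perm (Fin n)), R (vact (K := ℂ) colHom τ q) = R q)
    (S2 : ∀ (q : MvPolynomial (Fin n × Fin n) ℂ) (τ : Perm (Fin n)), S (vact (K := ℂ) colHom τ q) = τ • S q)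
    (S3 : ∀ (q : MvPolynomial (Fin n × Fin n) ℂ) (σ : Perm (Fin n)), S (vact (K := ℂ) rowHom σ q) = S q)
    (hRk : ∀ i, (R (L i)).card < k) (hSk : ∀ i, (S (L i)).card < k)
    (hRfix : ∀ (i : ι) (ρ : Perm (Fin n)), (∀ x ∈ R (L i), ρ x = x) → vact (K := ℂ) rowHom ρ (L i) = L i)
    (hSfix : ∀ (i : ι) (ρ : Perm (Fin n)), (∀ x ∈ S (L i), ρ x = x) → vact (K := ℂ) colHom ρ (L i) = L i) :
    (C a * ∏ i, L i) ^ 2 ∈ Submodule.span ℂ {p : MvPolynomial (Fin n × Fin n) ℂ |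
        ∃ (a b : ℕ) (E : Multiset (Fin a × Fin b)),
          treewidth (SimpleGraph.fromRel fun u v : Fin a ⊕ Fin b =>
            ∃ e ∈ E, u = Sum.inl e.1 ∧ v = Sum.inr e.2) ≤ 2 * k - 1 ∧ p = homPoly E n ℂ} := by
  classical
  have hL0 : ∀ i, L i ≠ 0 := by
    intro i h
    exact hf0 (by rw [Finset.prod_eq_zero (Finset.mem_univ i) h, mul_zero])
  -- labels
  set lab : MvPolynomial (Fin n × Fin n) ℂ → Finset (Fin n) × Finset (Fin n) := fun q => (R q, S q) with hlab
  have hlab_ren : ∀ (σ τ : Perm (Fin n)) (q : MvPolynomial (Fin n × Fin n) ℂ),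
      lab (rename (fun P : Fin n × Fin n => (σ P.1, τ P.2)) q) = (σ • (lab q).1, τ • (lab q).2) := by
    intro σ τ q
    simp only [hlab, rename_prod_eq, R2, R3, S3, S2]
  have hlab_unit : ∀ (q : MvPolynomial (Fin n × Fin n) ℂ) (u : ℂ), u ≠ 0 → lab (C u * q) = lab q := by
    intro q u hu
    simp only [hlab, R1 q u hu, S1 q u hu]
  have hact_inj : ∀ σ τ : Perm (Fin n), Function.Injective
      (fun l : Finset (Fin n) × Finset (Fin n) => (σ • l.1, τ • l.2)) := by
    intro σ τ l l' h
    simp only [Prod.mk.injEq] at h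
    exact Prod.ext (smul_left_cancel σ h.1) (smul_left_cancel τ h.2)
  have hrow' : ∀ (i : ι) (ρ : Perm (Fin n)), (∀ x ∈ R (L i), ρ x = x) →
      rename (fun P : Fin n × Fin n => (ρ P.1, P.2)) (L i) = L i := by
    intro i ρ hρ
    have h := hRfix i ρ hρ
    rw [vact_apply] at h
    have hf : (⇑(rowHom ρ) : Fin n × Fin n → Fin n × Fin n) = fun P => (ρ P.1, P.2) := funext (rowHom_apply ρ)
    rwa [hf] at h
  have hcol' : ∀ (i : ι) (ρ : Perm (Fin n)), (∀ x ∈ S (L i), ρ x = x) →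
      rename (fun P : Fin n × Fin n => (P.1, ρ P.2)) (L i) = L i := by
    intro i ρ hρ
    have h := hSfix i ρ hρ
    rw [vact_apply] at h
    have hf : (⇑(colHom ρ) : Fin n × Fin n → Fin n × Fin n) = fun P => (P.1, ρ P.2) := funext (colHom_apply ρ)
    rwa [hf] at h
  -- the blocks of the original family
  set Blk : Finset (Fin n) × Finset (Fin n) → MvPolynomial (Fin n × Fin n) ℂ :=
    fun l => ∏ i ∈ (univ : Finset ι).filter (fun i => lab (L i) = l), L i with hBlk
  have hBlk0 : ∀ l, Blk l ≠ 0 := fun l => Finset.prod_ne_zero_iff.2 fun i _ => hL0 i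
  -- block transport up to units
  have htrans : ∀ (σ τ : Perm (Fin n)) (l : Finset (Fin n) × Finset (Fin n)), ∃ c : ℂ, c ≠ 0 ∧
      rename (fun P : Fin n × Fin n => (σ P.1, τ P.2)) (Blk l) = C c * Blk (σ • l.1, τ • l.2) := by
    intro σ τ l
    obtain ⟨c, hc0, hc⟩ := exists_unit_labelBlock_rowCol L a hL1 hf0 σ τ (hfix σ τ) lab
      (fun l : Finset (Fin n) × Finset (Fin n) => (σ • l.1, τ • l.2)) (hact_inj σ τ) hlab_unit
      (fun i => hlab_ren σ τ (L i)) l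
    exact ⟨c, hc0, by simpa [hBlk] using hc⟩
  -- KEY: every block scalar of a label-fixing renaming is a sign, so squares of blocks are untwisted
  have hsq_untwisted : ∀ (σ τ : Perm (Fin n)) (l : Finset (Fin n) × Finset (Fin n)) (c : ℂ),
      rename (fun P : Fin n × Fin n => (σ P.1, τ P.2)) (Blk l ^ 2) = C c * Blk l ^ 2 → c = 1 := by
    intro σ τ l c h
    obtain ⟨A, T⟩ := l
    by_cases hl : ∃ i, lab (L i) = (A, T)
    · -- the label is fixed
      obtain ⟨u, hu0, hu⟩ := htrans σ τ (A, T)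
      have h' : C c * Blk (A, T) ^ 2 = C (u ^ 2) * Blk (σ • A, τ • T) ^ 2 := by
        rw [← h, map_pow, hu, mul_pow, ← map_pow]
      have hfixl : ((σ • A, τ • T) : Finset (Fin n) × Finset (Fin n)) = (A, T) :=
        label_eq_of_block_sq_eq L hL1 hL0 lab hlab_unit (A, T) (σ • A, τ • T) hl c (u ^ 2) (pow_ne_zero 2 hu0)
          (by simpa [hBlk] using h')
      have hσA : σ • A = A := congrArg Prod.fst hfixl
      have hτT : τ • T = T := congrArg Prod.snd hfixl
      rw [hσA, hτT] at hu
      -- the block as a placed polynomial local form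
      obtain ⟨P, hP⟩ := exists_polyU_block_eq_aeval L hL1 R S hrow' hcol' A T
      have hBP : Blk (A, T) = aeval (Sum.elim (Sum.elim
          (fun ab : Fin A.card × Fin T.card =>
            (X (((A.equivFin.symm ab.1 : A) : Fin n), ((T.equivFin.symm ab.2 : T) : Fin n)) : MvPolynomial (Fin n × Fin n) ℂ))
          (Sum.elim (fun a : Fin A.card => ∑ j : Fin n, (X (((A.equivFin.symm a : A) : Fin n), j) : MvPolynomial (Fin n × Fin n) ℂ))
            (fun b : Fin T.card => ∑ j : Fin n, (X (j, ((T.equivFin.symm b : T) : Fin n)) : MvPolynomial (Fin n × Fin n) ℂ))))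
          (fun _ : Unit => ∑ i : Fin n, ∑ j : Fin n, (X (i, j) : MvPolynomial (Fin n × Fin n) ℂ))) P := by
        simpa [hBlk, hlab] using hP
      -- range preservation from `σ • A = A`
      have hpresA : ∀ (ρ : Perm (Fin n)), ρ • A = A → ∀ i : Fin A.card, ∃ j : Fin A.card,
          ρ ((A.equivFin.symm i : A) : Fin n) = ((A.equivFin.symm j : A) : Fin n) := by
        intro ρ hρ i
        have hmem : ρ ((A.equivFin.symm i : A) : Fin n) ∈ A := by
          have h1 : ρ • ((A.equivFin.symm i : A) : Fin n) ∈ ρ • A := Finset.smul_mem_smul_finset (A.equivFin.symm i).2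
          rwa [hρ] at h1
        exact ⟨A.equivFin ⟨_, hmem⟩, by simp⟩
      have hpresT : ∀ (ρ : Perm (Fin n)), ρ • T = T → ∀ i : Fin T.card, ∃ j : Fin T.card,
          ρ ((T.equivFin.symm i : T) : Fin n) = ((T.equivFin.symm j : T) : Fin n) := by
        intro ρ hρ i
        have hmem : ρ ((T.equivFin.symm i : T) : Fin n) ∈ T := by
          have h1 : ρ • ((T.equivFin.symm i : T) : Fin n) ∈ ρ • T := Finset.smul_mem_smul_finset (T.equivFin.symm i).2
          rwa [hρ] at h1
        exact ⟨T.equivFin ⟨_, hmem⟩, by simp⟩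
      -- conversely, range preservation gives `ρ • A = A`, `ρ • T = T`
      have hsmulA : ∀ (ρ : Perm (Fin n)), (∀ i : Fin A.card, ∃ j : Fin A.card,
          ρ ((A.equivFin.symm i : A) : Fin n) = ((A.equivFin.symm j : A) : Fin n)) → ρ • A = A := by
        intro ρ hρ
        have hsub : ρ • A ⊆ A := by
          intro x hx
          obtain ⟨y, hy, rfl⟩ := Finset.mem_smul_finset.1 hx
          obtain ⟨j, hj⟩ := hρ (A.equivFin ⟨y, hy⟩)
          have hy' : ((A.equivFin.symm (A.equivFin ⟨y, hy⟩) : A) : Fin n) = y := by simp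
          rw [hy'] at hj
          rw [Perm.smul_def, hj]
          exact (A.equivFin.symm j).2
        exact Finset.eq_of_subset_of_card_le hsub (by rw [Finset.card_smul_finset])
      have hsmulT : ∀ (ρ : Perm (Fin n)), (∀ i : Fin T.card, ∃ j : Fin T.card,
          ρ ((T.equivFin.symm i : T) : Fin n) = ((T.equivFin.symm j : T) : Fin n)) → ρ • T = T := by
        intro ρ hρ
        have hsub : ρ • T ⊆ T := by
          intro x hx
          obtain ⟨y, hy, rfl⟩ := Finset.mem_smul_finset.1 hx
          obtain ⟨j, hj⟩ := hρ (T.equivFin ⟨y, hy⟩)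
          have hy' : ((T.equivFin.symm (T.equivFin ⟨y, hy⟩) : T) : Fin n) = y := by simp
          rw [hy'] at hj
          rw [Perm.smul_def, hj]
          exact (T.equivFin.symm j).2
        exact Finset.eq_of_subset_of_card_le hsub (by rw [Finset.card_smul_finset])
      -- every range-preserving renaming acts on the block by a scalar (transport + label fixed)
      have hscal : ∀ σ' τ' : Perm (Fin n),
          (∀ i : Fin A.card, ∃ j : Fin A.card, σ' ((A.equivFin.symm i : A) : Fin n) = ((A.equivFin.symm j : A) : Fin n)) →
          (∀ i : Fin T.card, ∃ j : Fin T.card, τ' ((T.equivFin.symm i : T) : Fin n) = ((T.equivFin.symm j : T) : Fin n)) →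
          ∃ v : ℂ, rename (fun Q : Fin n × Fin n => (σ' Q.1, τ' Q.2))
            (aeval (Sum.elim (Sum.elim
              (fun ab : Fin A.card × Fin T.card =>
                (X (((A.equivFin.symm ab.1 : A) : Fin n), ((T.equivFin.symm ab.2 : T) : Fin n)) : MvPolynomial (Fin n × Fin n) ℂ))
              (Sum.elim (fun a : Fin A.card => ∑ j : Fin n, (X (((A.equivFin.symm a : A) : Fin n), j) : MvPolynomial (Fin n × Fin n) ℂ))
                (fun b : Fin T.card => ∑ j : Fin n, (X (j, ((T.equivFin.symm b : T) : Fin n)) : MvPolynomial (Fin n × Fin n) ℂ))))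
              (fun _ : Unit => ∑ i : Fin n, ∑ j : Fin n, (X (i, j) : MvPolynomial (Fin n × Fin n) ℂ))) P) =
            C v * aeval (Sum.elim (Sum.elim
              (fun ab : Fin A.card × Fin T.card =>
                (X (((A.equivFin.symm ab.1 : A) : Fin n), ((T.equivFin.symm ab.2 : T) : Fin n)) : MvPolynomial (Fin n × Fin n) ℂ))
              (Sum.elim (fun a : Fin A.card => ∑ j : Fin n, (X (((A.equivFin.symm a : A) : Fin n), j) : MvPolynomial (Fin n × Fin n) ℂ))
                (fun b : Fin T.card => ∑ j : Fin n, (X (j, ((T.equivFin.symm b : T) : Fin n)) : MvPolynomial (Fin n × Fin n) ℂ))))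
              (fun _ : Unit => ∑ i : Fin n, ∑ j : Fin n, (X (i, j) : MvPolynomial (Fin n × Fin n) ℂ))) P := by
        intro σ' τ' hσ' hτ'
        obtain ⟨v, -, hv⟩ := htrans σ' τ' (A, T)
        refine ⟨v, ?_⟩
        rw [← hBP]
        rw [hv]
        simp only [hsmulA σ' hσ', hsmulT τ' hτ']
      have hB0' := hBlk0 (A, T)
      rw [hBP] at hB0'
      have hu' := hu
      rw [hBP] at hu'
      have hsign := blockScalar_eq_one_or_eq_neg_one P _ _
        (fun i j hij => A.equivFin.symm.injective (Subtype.ext hij))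
        (fun i j hij => T.equivFin.symm.injective (Subtype.ext hij)) hB0' hscal σ τ (hpresA σ hσA) (hpresT τ hτT) u hu'
      have hu2 : u ^ 2 = 1 := by
        rcases hsign with h1 | h1 <;> simp [h1]
      rw [hfixl, hu2, C_1, one_mul] at h'
      -- `C c * X = X` with `X ≠ 0`
      have hX : Blk (A, T) ^ 2 ≠ 0 := pow_ne_zero 2 (hBlk0 (A, T))
      have := mul_right_cancel₀ hX (h'.trans (one_mul _).symm)
      exact C_injective _ _ (this.trans C_1.symm)
    · -- empty block
      have hempty : Blk (A, T) = 1 := by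
        simp only [hBlk]
        refine Finset.prod_eq_one fun i hi => ?_
        exact absurd ⟨i, (Finset.mem_filter.1 hi).2⟩ hl
      rw [hempty, one_pow, map_one, mul_one] at h
      exact C_injective _ _ (h.symm.trans C_1.symm)
  -- the doubled family
  set L₂ : ι ⊕ ι → MvPolynomial (Fin n × Fin n) ℂ := Sum.elim L L with hL₂
  have hprod₂ : (∏ i, L₂ i) = (∏ i, L i) ^ 2 := by
    rw [Fintype.prod_sum_type, pow_two]
    simp [hL₂]
  have hf₂ : C (a * a) * ∏ i, L₂ i = (C a * ∏ i, L i) ^ 2 := by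
    rw [hprod₂, map_mul]
    ring
  have hL1₂ : ∀ i, (L₂ i).totalDegree = 1 := by
    rintro (i | i) <;> exact hL1 i
  have hf0₂ : C (a * a) * ∏ i, L₂ i ≠ 0 := by
    rw [hf₂]
    exact pow_ne_zero 2 hf0
  have hfix₂ : ∀ σ τ : Perm (Fin n),
      rename (fun P : Fin n × Fin n => (σ P.1, τ P.2)) (C (a * a) * ∏ i, L₂ i) = C (a * a) * ∏ i, L₂ i := by
    intro σ τ
    rw [hf₂, map_pow, hfix σ τ]
  have hRk₂ : ∀ i, (R (L₂ i)).card < k := by rintro (i | i) <;> exact hRk i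
  have hSk₂ : ∀ i, (S (L₂ i)).card < k := by rintro (i | i) <;> exact hSk i
  have hRfix₂ : ∀ (i : ι ⊕ ι) (ρ : Perm (Fin n)), (∀ x ∈ R (L₂ i), ρ x = x) →
      vact (K := ℂ) rowHom ρ (L₂ i) = L₂ i := by
    rintro (i | i) <;> exact hRfix i
  have hSfix₂ : ∀ (i : ι ⊕ ι) (ρ : Perm (Fin n)), (∀ x ∈ S (L₂ i), ρ x = x) →
      vact (K := ℂ) colHom ρ (L₂ i) = L₂ i := by
    rintro (i | i) <;> exact hSfix i
  have hblock₂ : ∀ (σ τ : Perm (Fin n)) (l : Finset (Fin n) × Finset (Fin n)) (c : ℂ),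
      rename (fun P : Fin n × Fin n => (σ P.1, τ P.2))
          (∏ i ∈ (univ : Finset (ι ⊕ ι)).filter (fun i => (R (L₂ i), S (L₂ i)) = l), L₂ i) =
        C c * ∏ i ∈ (univ : Finset (ι ⊕ ι)).filter (fun i => (R (L₂ i), S (L₂ i)) = l), L₂ i → c = 1 := by
    intro σ τ l c h
    have hB₂ : (∏ i ∈ (univ : Finset (ι ⊕ ι)).filter (fun i => (R (L₂ i), S (L₂ i)) = l), L₂ i) = Blk l ^ 2 := by
      rw [Finset.prod_filter, Fintype.prod_sum_type, pow_two]
      simp only [hL₂, Sum.elim_inl, Sum.elim_inr, hBlk, hlab, Finset.prod_filter]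
    rw [hB₂] at h
    exact hsq_untwisted σ τ l c h
  rw [← hf₂]
  exact prod_mem_narrowSpan_of_supportBlockUntwisted hk L₂ (a * a) hL1₂ hf0₂ hfix₂ R S R1 S1 R2 R3 S2 S3 hRk₂ hSk₂
    hRfix₂ hSfix₂ hblock₂

end NormalisedFactors

end Summit.ValiantsHypothesis.ValiantsHypothesis.Theorems

end
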